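import Literature.MathematicalPhysics.KineticTheory.InfiniteChainClusteringTransfer
import Literature.MathematicalPhysics.KineticTheory.ChainMixingClustering

/-!
# Stub F `stub_richFramework` of line `kinetic-polymer-gas-on-the-time-axis`, part R-T: the
two-sided clustering transfer and weighted-moment tools
(crux `EmbeddedDrudeMourre.DrudeDissolution`, stmt-AtomisticToContinuum-12593; `--supports` file)

The rich zero-wavenumber datum of stub F has observables the ALGEBRA generated by the flow-orbit of
the local polynomials, i.e. the span of the multi-time monomials `Π_i (u_i ∘ φ_{s_i})`. Neither
argument of a truncated correlation `Cov_μ(M, M' ∘ τ_x)` of two such monomials is box-local, so the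
tree's one-sided transfer `summable_covariance_comp_chainShift` (first argument box-local) does not
apply. This file proves the two-sided version in ABSTRACT form: a sequence `c : ℤ → ℝ` which, for
every `n`, is approximated UNIFORMLY in `x` within `ε_n` (summable) by the truncated correlations
`Cov_μ(h_n, h'_n ∘ τ_x)` of two box-local observables of controlled `L²` size is absolutely
summable, with a summable majorant depending only on `(C, m, K, G, ε)` (`richFramework_transfer`;
box form of exponential `ρ`-mixing at the scale `n = |x|/4`). It also collects the elementary
weighted-moment tools (`|Cov(X,Y)| ≤ ∫ |X| |Y - EY|`, pointwise power bounds, integrability of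
weighted products) used by the companion parts R-M (monomials) and R-C (clustering).
-/

noncomputable section

open MeasureTheory ProbabilityTheory Set Filter Topology Function Real
open scoped InnerProductSpace ENNReal BigOperators
open Literature.MathematicalPhysics.KineticTheory
open Literature.MathematicalPhysics.KineticTheory.HeatConduction

namespace Summit.AtomisticToContinuum.FouriersLaw.Theorems.DrudeDissolution.KineticPolymerGasOnTheTimeAxis

/-! ## Weighted-moment tools -/

section Tools

variable {Ω : Type*} [MeasurableSpace Ω] {μ : Measure Ω}

/-- **`|Cov(X, Y)| ≤ ∫ |X| · |Y - EY|`** for square-integrable `X, Y` under a probability measure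
(`Cov(X, Y) = E[X (Y - EY)]`). [folklore] -/
theorem abs_covariance_le_integral_abs_mul [IsProbabilityMeasure μ] {X Y : Ω → ℝ}
    (hX : MemLp X 2 μ) (hY : MemLp Y 2 μ) :
    |cov[X, Y; μ]| ≤ ∫ ω, |X ω| * |Y ω - ∫ ω', Y ω' ∂μ| ∂μ := by
  have hYi : Integrable Y μ := hY.integrable one_le_two
  have hYc : MemLp (fun ω => Y ω - ∫ ω', Y ω' ∂μ) 2 μ := hY.sub (memLp_const _)
  have h0 : ∫ ω, (Y ω - ∫ ω', Y ω' ∂μ) ∂μ = 0 := by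
    rw [integral_sub hYi (integrable_const _), integral_const, probReal_univ, one_smul, sub_self]
  have h1 : cov[X, Y; μ] = ∫ ω, X ω * (Y ω - ∫ ω', Y ω' ∂μ) ∂μ := by
    rw [← covariance_sub_const_right hYi (∫ ω', Y ω' ∂μ), covariance_eq_sub hX hYc, h0, mul_zero,
      sub_zero]
    rfl
  rw [h1]
  refine abs_integral_le_integral_abs.trans (le_of_eq (integral_congr_ae (Eventually.of_forall
    fun ω => ?_)))
  simp only [abs_mul]

/-- `w ^ j ≤ 1 + w ^ k` for `0 ≤ w` and `j ≤ k`. [folklore] -/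
theorem pow_le_one_add_pow {w : ℝ} (hw : 0 ≤ w) {j k : ℕ} (hjk : j ≤ k) : w ^ j ≤ 1 + w ^ k := by
  rcases le_total w 1 with h1 | h1
  · have : w ^ j ≤ 1 := pow_le_one₀ hw h1
    have : 0 ≤ w ^ k := pow_nonneg hw k
    linarith
  · have : w ^ j ≤ w ^ k := pow_le_pow_right₀ h1 hjk
    linarith

/-- `(a b)^k ≤ a^{2k} + b^{2k}` for `a, b ≥ 0`. [folklore] -/
theorem mul_pow_le_pow_add_pow {a b : ℝ} (ha : 0 ≤ a) (hb : 0 ≤ b) (k : ℕ) :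
    (a * b) ^ k ≤ a ^ (2 * k) + b ^ (2 * k) := by
  have h1 : a ^ (2 * k) = (a ^ k) ^ 2 := by rw [pow_mul']
  have h2 : b ^ (2 * k) = (b ^ k) ^ 2 := by rw [pow_mul']
  rw [mul_pow, h1, h2]
  have h3 : 0 ≤ a ^ k * b ^ k := mul_nonneg (pow_nonneg ha k) (pow_nonneg hb k)
  nlinarith [two_mul_le_add_sq (a ^ k) (b ^ k)]

/-- `x y z ≤ x⁴ + y⁴ + z²` for `x, y, z ≥ 0`. [folklore] -/
theorem mul_mul_le_pow_four_add {x y z : ℝ} (hx : 0 ≤ x) (hy : 0 ≤ y) (hz : 0 ≤ z) :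
    x * y * z ≤ x ^ 4 + y ^ 4 + z ^ 2 := by
  have h1 : 2 * (x * y) * z ≤ (x * y) ^ 2 + z ^ 2 := two_mul_le_add_sq (x * y) z
  have h2 : 2 * x ^ 2 * y ^ 2 ≤ (x ^ 2) ^ 2 + (y ^ 2) ^ 2 := two_mul_le_add_sq (x ^ 2) (y ^ 2)
  have h3 : 0 ≤ x * y * z := mul_nonneg (mul_nonneg hx hy) hz
  nlinarith

/-- **Integrability of a weighted product** `|a - c| · |b w|` from fourth moments of `a, b, c` and
the second moment of `w`. [folklore] -/
theorem integrable_abs_sub_mul_abs_mul {a b c w : Ω → ℝ} (ham : Measurable a) (hbm : Measurable b)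
    (hcm : Measurable c) (hwm : Measurable w) (ha : Integrable (fun ω => |a ω| ^ 4) μ)
    (hb : Integrable (fun ω => |b ω| ^ 4) μ) (hc : Integrable (fun ω => |c ω| ^ 4) μ)
    (hw : Integrable (fun ω => |w ω| ^ 2) μ) :
    Integrable (fun ω => |a ω - c ω| * |b ω * w ω|) μ := by
  refine Integrable.mono' (((ha.add hc).const_mul 8).add (hb.add hw))
    ((((ham.sub hcm).abs).mul ((hbm.mul hwm).abs)).aestronglyMeasurable)
    (Eventually.of_forall fun ω => ?_)
  rw [Real.norm_eq_abs, abs_of_nonneg (mul_nonneg (abs_nonneg _) (abs_nonneg _)), abs_mul,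
    ← mul_assoc]
  have h1 := mul_mul_le_pow_four_add (abs_nonneg (a ω - c ω)) (abs_nonneg (b ω)) (abs_nonneg (w ω))
  have h2 : |a ω - c ω| ^ 4 ≤ 8 * (|a ω| ^ 4 + |c ω| ^ 4) := by
    have h4 : Even 4 := by decide
    rw [h4.pow_abs, h4.pow_abs, h4.pow_abs]
    -- `8(a⁴+c⁴) - (a-c)⁴ = (a+c)⁴ + 6(a²-c²)²` (cf. `Literature.Analysis.FunctionSpaces.pow_four_sub_le`)
    have e : 8 * (a ω ^ 4 + c ω ^ 4) - (a ω - c ω) ^ 4 = (a ω + c ω) ^ 4 + 6 * (a ω ^ 2 - c ω ^ 2) ^ 2 := by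
      ring
    have : 0 ≤ (a ω + c ω) ^ 4 + 6 * (a ω ^ 2 - c ω ^ 2) ^ 2 := by positivity
    linarith
  simp only [Pi.add_apply]
  linarith

/-- **Moment of a product weight**: for `2k₁ ≤ k`, `∫ |b w|^{k₁} ≤ ∫ |b|^{2k₁} + 1 + ∫ |w|^k`
(and the left side is integrable), under a probability measure. [folklore] -/
theorem integral_abs_mul_pow_le [IsProbabilityMeasure μ] {b w : Ω → ℝ} (hbm : Measurable b)
    (hwm : Measurable w) {k₁ k : ℕ} (hk : 2 * k₁ ≤ k) (hb : Integrable (fun ω => |b ω| ^ (2 * k₁)) μ)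
    (hw : Integrable (fun ω => |w ω| ^ k) μ) :
    Integrable (fun ω => |b ω * w ω| ^ k₁) μ ∧
      ∫ ω, |b ω * w ω| ^ k₁ ∂μ ≤ (∫ ω, |b ω| ^ (2 * k₁) ∂μ) + (1 + ∫ ω, |w ω| ^ k ∂μ) := by
  have hpt : ∀ ω, |b ω * w ω| ^ k₁ ≤ |b ω| ^ (2 * k₁) + (1 + |w ω| ^ k) := fun ω => by
    rw [abs_mul]
    refine (mul_pow_le_pow_add_pow (abs_nonneg _) (abs_nonneg _) k₁).trans ?_
    have := pow_le_one_add_pow (abs_nonneg (w ω)) hk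
    linarith
  have hg : Integrable (fun ω => |b ω| ^ (2 * k₁) + (1 + |w ω| ^ k)) μ :=
    hb.add (g := fun ω => 1 + |w ω| ^ k) ((integrable_const 1).add hw)
  have hint : Integrable (fun ω => |b ω * w ω| ^ k₁) μ :=
    Integrable.mono' hg (((hbm.mul hwm).abs.pow_const k₁).aestronglyMeasurable)
      (Eventually.of_forall fun ω => by
        rw [Real.norm_eq_abs, abs_of_nonneg (pow_nonneg (abs_nonneg _) _)]
        exact hpt ω)
  refine ⟨hint, ?_⟩
  calc ∫ ω, |b ω * w ω| ^ k₁ ∂μ ≤ ∫ ω, |b ω| ^ (2 * k₁) + (1 + |w ω| ^ k) ∂μ :=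
        integral_mono hint hg hpt
    _ = (∫ ω, |b ω| ^ (2 * k₁) ∂μ) + (1 + ∫ ω, |w ω| ^ k ∂μ) := by
        rw [integral_add (g := fun ω => 1 + |w ω| ^ k) hb ((integrable_const 1).add hw),
          integral_add (f := fun _ => (1 : ℝ)) (g := fun ω => |w ω| ^ k) (integrable_const 1) hw,
          integral_const, probReal_univ, one_smul]

/-- **Moment of a centred weight**: `∫ |Y - c|^k ≤ 2^(k-1) (∫ |Y|^k + |c|^k)` (and integrable),
under a probability measure. [folklore] -/
theorem integral_abs_sub_const_pow_le [IsProbabilityMeasure μ] {Y : Ω → ℝ} (hYm : Measurable Y)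
    (k : ℕ) (hY : Integrable (fun ω => |Y ω| ^ k) μ) (c : ℝ) :
    Integrable (fun ω => |Y ω - c| ^ k) μ ∧
      ∫ ω, |Y ω - c| ^ k ∂μ ≤ 2 ^ (k - 1) * ((∫ ω, |Y ω| ^ k ∂μ) + |c| ^ k) := by
  have hpt : ∀ ω, |Y ω - c| ^ k ≤ 2 ^ (k - 1) * (|Y ω| ^ k + |c| ^ k) := fun ω =>
    (pow_le_pow_left₀ (abs_nonneg _) (abs_sub _ _) k).trans
      (add_pow_le (abs_nonneg _) (abs_nonneg _) k)
  have hg : Integrable (fun ω => 2 ^ (k - 1) * (|Y ω| ^ k + |c| ^ k)) μ :=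
    (hY.add (integrable_const _)).const_mul _
  have hint : Integrable (fun ω => |Y ω - c| ^ k) μ :=
    Integrable.mono' hg (((hYm.sub measurable_const).abs.pow_const k).aestronglyMeasurable)
      (Eventually.of_forall fun ω => by
        rw [Real.norm_eq_abs, abs_of_nonneg (pow_nonneg (abs_nonneg _) _)]
        exact hpt ω)
  refine ⟨hint, ?_⟩
  calc ∫ ω, |Y ω - c| ^ k ∂μ ≤ ∫ ω, 2 ^ (k - 1) * (|Y ω| ^ k + |c| ^ k) ∂μ := integral_mono hint hg hpt
    _ = 2 ^ (k - 1) * ((∫ ω, |Y ω| ^ k ∂μ) + |c| ^ k) := by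
        rw [integral_const_mul, integral_add hY (integrable_const _), integral_const, probReal_univ,
          one_smul]

/-- **Weighted Cauchy–Schwarz**: `∫ |f| |W| ≤ (∫ f²)^{1/2} (∫ |W|²)^{1/2}`. [folklore] -/
theorem integral_abs_mul_abs_le_sqrt {f W : Ω → ℝ} (hf : MemLp f 2 μ) (hWm : Measurable W)
    (hW : Integrable (fun ω => |W ω| ^ 2) μ) :
    ∫ ω, |f ω| * |W ω| ∂μ ≤ Real.sqrt (∫ ω, f ω ^ 2 ∂μ) * Real.sqrt (∫ ω, |W ω| ^ 2 ∂μ) := by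
  have hW2 : MemLp (fun ω => |W ω|) 2 μ :=
    (memLp_two_iff_integrable_sq hWm.abs.aestronglyMeasurable).2 hW
  have h := abs_integral_mul_le_sqrt_integral_sq_mul (f := fun ω => |f ω|) hf.abs hW2
  rw [show (fun ω => |W ω| ^ 2) = fun ω => W ω ^ 2 from funext fun ω => sq_abs _]
  simp only [sq_abs] at h
  exact (le_abs_self _).trans h

/-- `∫ F ∘ S dμ = ∫ F dμ` for a measure-preserving `S`. [folklore] -/
theorem integral_comp_eq_of_measurePreserving {S : Ω → Ω} (hS : MeasurePreserving S μ μ)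
    {F : Ω → ℝ} (hF : AEStronglyMeasurable F μ) : ∫ ω, F (S ω) ∂μ = ∫ ω, F ω ∂μ := by
  have hF' : AEStronglyMeasurable F (Measure.map S μ) := by rwa [hS.map_eq]
  rw [← integral_map hS.measurable.aemeasurable hF', hS.map_eq]

end Tools

/-! ## The two-sided clustering transfer -/

/-- **Part R-T of stub F (registered helper): two-sided clustering transfer.** Under exponential
`ρ`-mixing of `μ` between half-lines (registered form, rate `m > 0`) and translation invariance,
fix a locality margin `K`, a level `G` and a summable rate `ε ≥ 0`. There is a summable
`F : ℤ → ℝ` such that EVERY sequence `c : ℤ → ℝ` which, for each `n`, is within `ε n` — uniformly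
in `x` — of the truncated correlations `x ↦ Cov_μ(h, h' ∘ τ_x)` of two measurable observables
`h, h'` reading the box `[-(n+K), n+K]` with `(∫ h²)^{1/2}, (∫ h'²)^{1/2} ≤ G`, satisfies
`|c x| ≤ F x` for all `x` (choose `n = |x|/4` and use the box form of mixing,
`abs_covariance_comp_chainShift_le_of_mixing`). [folklore] -/
theorem richFramework_transfer : ∀ (μ : MeasureTheory.Measure (ℤ → ℝ × ℝ)) [MeasureTheory.IsProbabilityMeasure μ] (C m : ℝ), 0 < m → (∀ (p : ℤ) (n : ℕ) (f g : (ℤ → ℝ × ℝ) → ℝ), DependsOn f {i : ℤ | i ≤ p} → DependsOn g {i : ℤ | p + n ≤ i} → Measurable f → Measurable g → MeasureTheory.MemLp f 2 μ → MeasureTheory.MemLp g 2 μ → |MeasureTheory.integral μ (fun σ => f σ * g σ) - MeasureTheory.integral μ f * MeasureTheory.integral μ g| ≤ C * Real.exp (-(m * n)) * (MeasureTheory.integral μ (fun σ => f σ ^ 2)) ^ (1 / 2 : ℝ) * (MeasureTheory.integral μ (fun σ => g σ ^ 2)) ^ (1 / 2 : ℝ)) → (∀ x : ℤ, MeasureTheory.MeasurePreserving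 (Literature.MathematicalPhysics.KineticTheory.HeatConduction.chainShift x) μ μ) → ∀ (K : ℕ) (G : ℝ) (ε : ℕ → ℝ), (∀ n, 0 ≤ ε n) → Summable ε → ∃ F : ℤ → ℝ, Summable F ∧ ∀ c : ℤ → ℝ, (∀ n : ℕ, ∃ h h' : (ℤ → ℝ × ℝ) → ℝ, DependsOn h (Set.Icc (-((n + K : ℕ) : ℤ)) (n + K : ℕ)) ∧ DependsOn h' (Set.Icc (-((n + K : ℕ) : ℤ)) (n + K : ℕ)) ∧ Measurable h ∧ Measurable h' ∧ MeasureTheory.MemLp h 2 μ ∧ MeasureTheory.MemLp h' 2 μ ∧ Real.sqrt (MeasureTheory.integral μ (fun σ => h σ ^ 2)) ≤ G ∧ Real.sqrt (MeasureTheory.integral μ (fun σ => h' σ ^ 2)) ≤ G ∧ ∀ x : ℤ, |c x - ProbabilityTheory.covariance h (h' ∘ Literature.MathematicalPhysics.KineticTheory.HeatConduction.chainShift x) μ| ≤ ε n) → ∀ x : ℤ, |c x| ≤ F x := by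
  intro μ _ C m hm hmix hτ K G ε hε0 hε
  set G' : ℝ := max G 0 with hG'
  have hG'0 : 0 ≤ G' := le_max_right _ _
  have hC0 : 0 ≤ max C 1 := zero_le_one.trans (le_max_right _ _)
  -- the geometric factor at margin `2K`
  let e : ℤ → ℝ := fun x =>
    Real.exp (-(m * (((|x| - ((x.natAbs / 2 + 2 * K : ℕ) : ℤ) - (0 : ℕ)).toNat : ℕ) : ℝ)))
  have heZ : Summable e := summable_exp_neg_mul_gap hm (2 * K) 0
  have hεZ : Summable fun x : ℤ => ε (x.natAbs / 2 / 2) := by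
    have h1 : Summable fun n : ℕ => ε (n / 2) := summable_comp_div_two hε0 hε
    have h2 : Summable fun n : ℕ => ε (n / 2 / 2) := summable_comp_div_two (fun n => hε0 _) h1
    exact summable_int_comp_natAbs h2
  refine ⟨fun x => ε (x.natAbs / 2 / 2) + max C 1 * G' * G' * e x, hεZ.add (heZ.mul_left _), ?_⟩
  intro c hc x
  set n : ℕ := x.natAbs / 2 / 2 with hn
  obtain ⟨h, h', hd, hd', hhm, hhm', h2, h2', hG1, hG2, happ⟩ := hc n
  have hcov := abs_covariance_comp_chainShift_le_of_mixing hmix hτ hd hhm h2 hd' hhm' h2' x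
  -- compare the two gaps
  have hgap : (|x| - ((x.natAbs / 2 + 2 * K : ℕ) : ℤ) - (0 : ℕ)).toNat ≤
      (|x| - ((n + K : ℕ) : ℤ) - ((n + K : ℕ) : ℤ)).toNat := by
    apply Int.toNat_le_toNat
    have h1 : (n + K) + (n + K) ≤ x.natAbs / 2 + 2 * K + 0 := by rw [hn]; omega
    have h2 : ((n + K : ℕ) : ℤ) + ((n + K : ℕ) : ℤ) ≤ ((x.natAbs / 2 + 2 * K : ℕ) : ℤ) + ((0 : ℕ) : ℤ) := by
      exact_mod_cast h1
    linarith
  have hexp : Real.exp (-(m * (((|x| - ((n + K : ℕ) : ℤ) - ((n + K : ℕ) : ℤ)).toNat : ℕ) : ℝ))) ≤ e x := by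
    apply Real.exp_le_exp.2
    have : (((|x| - ((x.natAbs / 2 + 2 * K : ℕ) : ℤ) - (0 : ℕ)).toNat : ℕ) : ℝ) ≤
        (((|x| - ((n + K : ℕ) : ℤ) - ((n + K : ℕ) : ℤ)).toNat : ℕ) : ℝ) := by exact_mod_cast hgap
    nlinarith
  have hs1 : Real.sqrt (∫ σ, h σ ^ 2 ∂μ) ≤ G' := hG1.trans (le_max_left _ _)
  have hs2 : Real.sqrt (∫ σ, h' σ ^ 2 ∂μ) ≤ G' := hG2.trans (le_max_left _ _)
  have hbound : |cov[h, h' ∘ chainShift x; μ]| ≤ max C 1 * G' * G' * e x := by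
    refine hcov.trans ?_
    have hA : 0 ≤ Real.sqrt (∫ σ, h σ ^ 2 ∂μ) := Real.sqrt_nonneg _
    have hB : 0 ≤ Real.sqrt (∫ σ, h' σ ^ 2 ∂μ) := Real.sqrt_nonneg _
    have hE : 0 ≤ Real.exp (-(m * (((|x| - ((n + K : ℕ) : ℤ) - ((n + K : ℕ) : ℤ)).toNat : ℕ) : ℝ))) :=
      (Real.exp_pos _).le
    calc max C 1 * Real.exp (-(m * (((|x| - ((n + K : ℕ) : ℤ) - ((n + K : ℕ) : ℤ)).toNat : ℕ) : ℝ))) *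
          Real.sqrt (∫ σ, h σ ^ 2 ∂μ) * Real.sqrt (∫ σ, h' σ ^ 2 ∂μ)
        ≤ max C 1 * e x * G' * G' := by
          have h3 : max C 1 * Real.exp (-(m * (((|x| - ((n + K : ℕ) : ℤ) - ((n + K : ℕ) : ℤ)).toNat : ℕ) : ℝ)))
              ≤ max C 1 * e x := mul_le_mul_of_nonneg_left hexp hC0
          have h4 : 0 ≤ max C 1 * e x := mul_nonneg hC0 (Real.exp_pos _).le
          exact mul_le_mul (mul_le_mul h3 hs1 hA h4) hs2 hB (mul_nonneg h4 hG'0)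
      _ = max C 1 * G' * G' * e x := by ring
  have htri : |c x| ≤ |c x - cov[h, h' ∘ chainShift x; μ]| + |cov[h, h' ∘ chainShift x; μ]| := by
    have := abs_add_le (c x - cov[h, h' ∘ chainShift x; μ]) (cov[h, h' ∘ chainShift x; μ])
    rwa [sub_add_cancel] at this
  exact htri.trans (add_le_add (happ x) hbound)

end Summit.AtomisticToContinuum.FouriersLaw.Theorems.DrudeDissolution.KineticPolymerGasOnTheTimeAxis

end
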